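import Literature.RepresentationTheory.ClassicalInvariants.SphericalHarmonics
import Mathlib.Algebra.Polynomial.Derivative
import Mathlib.Algebra.Polynomial.AlgebraMap
import HarnessLib

/-!
# Spherical harmonics: the `𝔰𝔩₂`-modules `U_f = ⊕ⱼ k·r²ʲ f` (Goodman–Wallach, Theorem 5.6.11 (1))

Goodman–Wallach, *Symmetry, Representations, and Invariants* (GTM 255), § 5.6.4, proof of
Theorem 5.6.11: the lowest-weight modules `M_μ` (`π_μ(Y)v_j = v_{j+1}`, `π_μ(H)v_j = (μ − 2j)v_j`,
`π_μ(X)v_j = j(μ − j + 1)v_{j−1}`), the claim (⋆) and (5.88)/(5.89) `U_f = ⊕_{j ≥ 0} ℂ r²ʲ f ≅ M_{−(k+n/2)}`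
for a harmonic `f ∈ ℋᵏ`, and statement (1) "`ℰᵏ` is an irreducible `𝔤′`-module"
[GoodmanWallachGTM255]. Continuation of `ClassicalInvariants.SphericalHarmonics` (same conventions:
a field `k` of characteristic `0`, `n = |σ| ≥ 1` variables, `Δ`, `r²` passed as hypotheses `hΔ`,
`hr2`; `X = −½Δ`, `Y = ½r²`, `H = −E − n/2`). Everything proved, no definitions.

* `laplacian_rsq_pow_succ_mul` — for `f ∈ ℋᵐ`: `Δ(r^{2(j+1)} f) = 2(j+1)(2m+2j+n) r²ʲ f` (so
  `X v_{j+1} = (j+1)(μ−j) v_j` for `v_j = 2^{−j} r²ʲ f`, `μ = −(m + n/2)`): `tds_Y`, `tds_H`, `tds_X` —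
  **`U_f ≅ M_μ`** on the basis `v_j`;
* `linearIndependent_rsq_pow_mul` — (5.89) is a direct sum ("each summand is homogeneous of a
  different degree");
* `laplacian_aeval_rsq_mul` — on `U_f = {p(r²) f}` the Laplacian acts through the degree-lowering
  operator `p ↦ (4m+2n) p′ + 4 t p″` on `k[t]`;
* **Theorem 5.6.11 (1)** `forall_aeval_rsq_mul_mem` / `span_rsq_pow_mul_le` — `U_f` is irreducible
  under `{Δ, r²}`: a subspace stable under `Δ` and multiplication by `r²` that contains one nonzero
  `p(r²) f` contains all of `U_f` (`f ∈ ℋᵐ`, `f ≠ 0`).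

References: R. Goodman, N. R. Wallach, GTM 255, Springer 2009, § 5.6.4, Theorem 5.6.11 and its
proof ((⋆), (5.88), (5.89)) [GoodmanWallachGTM255].
-/

open MvPolynomial
open scoped BigOperators

universe u v

namespace Literature.RepresentationTheory.ClassicalInvariants.SphericalHarmonicsSL2

open Literature.RepresentationTheory.ClassicalInvariants.SphericalHarmonics

variable {k : Type u} [Field k] {σ : Type v} [Fintype σ]

/-! ## § 1. `Δ(r^{2(j+1)} f) = 2(j+1)(2m+2j+n) r^{2j} f` and the `M_μ` formulas -/

omit [Fintype σ] in
/-- `r²ʲ f` is homogeneous of degree `2j + m`. [folklore] -/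
private theorem rsq_pow_mul_isHomogeneous [Fintype σ] (r2 : MvPolynomial σ k)
    (hr2 : r2 = ∑ i : σ, X i ^ 2) {f : MvPolynomial σ k} {m : ℕ} (hf : f.IsHomogeneous m) (j : ℕ) :
    (r2 ^ j * f).IsHomogeneous (2 * j + m) := by
  have h2 : r2.IsHomogeneous 2 := by
    rw [hr2]
    exact IsHomogeneous.sum _ _ _ fun i _ => by simpa using (isHomogeneous_X k i).pow 2
  exact (h2.pow j).mul hf

/-- **The Laplacian on `U_f`**: for `f` harmonic and homogeneous of degree `m`,
`Δ(r^{2(j+1)} f) = 2(j+1)(2m + 2j + n) · r^{2j} f` (`n = |σ|`). With `v_j = 2^{−j} r^{2j} f` and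
`μ = −(m + n/2)` this is `π_μ(X) v_{j+1} = (j+1)(μ − j) v_j`, the `M_μ`-formula in the proof of
Theorem 5.6.11. [cite: GoodmanWallachGTM255, Theorem 5.6.11 (proof: the modules M_μ and (5.89))] -/
theorem laplacian_rsq_pow_succ_mul [CharZero k] (Δ : MvPolynomial σ k →ₗ[k] MvPolynomial σ k)
    (hΔ : ∀ f, Δ f = ∑ i : σ, pderiv i (pderiv i f)) (r2 : MvPolynomial σ k)
    (hr2 : r2 = ∑ i : σ, X i ^ 2) {f : MvPolynomial σ k} {m : ℕ} (hf : f.IsHomogeneous m)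
    (hharm : Δ f = 0) (j : ℕ) :
    Δ (r2 ^ (j + 1) * f) =
      ((2 * (j + 1) * (2 * m + 2 * j + Fintype.card σ) : ℕ) : MvPolynomial σ k) * (r2 ^ j * f) := by
  induction j with
  | zero =>
    rw [zero_add, pow_one, pow_zero, one_mul, laplacian_rsq_mul_of_isHomogeneous Δ hΔ r2 hr2 hf,
      hharm, mul_zero, zero_add]
    push_cast; ring
  | succ j ih =>
    rw [pow_succ', mul_assoc, laplacian_rsq_mul_of_isHomogeneous Δ hΔ r2 hr2
      (rsq_pow_mul_isHomogeneous r2 hr2 hf (j + 1)), ih]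
    push_cast; ring

omit [Fintype σ] in
/-- **`π_μ(Y) v_j = v_{j+1}`** for `Y = ½r²`, `v_j = 2^{−j} r^{2j} f`.
[cite: GoodmanWallachGTM255, Theorem 5.6.11 (proof: the modules M_μ)] -/
theorem tds_Y (r2 f : MvPolynomial σ k) (j : ℕ) :
    (1 / 2 : k) • (r2 * ((1 / 2 ^ j : k) • (r2 ^ j * f))) =
      (1 / 2 ^ (j + 1) : k) • (r2 ^ (j + 1) * f) := by
  rw [mul_smul_comm, smul_smul, ← mul_assoc, ← pow_succ']
  congr 1
  rw [pow_succ, one_div, one_div, one_div, mul_inv, mul_comm]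

/-- **`π_μ(H) v_j = (μ − 2j) v_j`** for `H = −E − n/2`, `μ = −(m + n/2)`: `r^{2j} f` is homogeneous of
degree `m + 2j`, so `E(r^{2j} f) = (m + 2j) r^{2j} f`.
[cite: GoodmanWallachGTM255, Theorem 5.6.11 (proof: the modules M_μ), with (5.87)] -/
theorem tds_H (r2 : MvPolynomial σ k) (hr2 : r2 = ∑ i : σ, X i ^ 2) {f : MvPolynomial σ k}
    {m : ℕ} (hf : f.IsHomogeneous m) (j : ℕ) :
    -(∑ i : σ, X i * pderiv i ((1 / 2 ^ j : k) • (r2 ^ j * f))) -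
        ((Fintype.card σ : k) / 2) • ((1 / 2 ^ j : k) • (r2 ^ j * f)) =
      ((-((m : k) + (Fintype.card σ : k) / 2)) - 2 * (j : k)) • ((1 / 2 ^ j : k) • (r2 ^ j * f)) := by
  have hE : ∑ i : σ, X i * pderiv i (r2 ^ j * f) = (2 * j + m) • (r2 ^ j * f) :=
    (rsq_pow_mul_isHomogeneous r2 hr2 hf j).sum_X_mul_pderiv
  simp_rw [Derivation.map_smul, mul_smul_comm, ← Finset.smul_sum, hE, ← Nat.cast_smul_eq_nsmul k]
  push_cast
  module

/-- **`π_μ(X) v_{j+1} = (j+1)(μ − j) v_j`** for `X = −½Δ`, `v_j = 2^{−j} r^{2j} f`, `μ = −(m + n/2)`,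
`f ∈ ℋᵐ`. [cite: GoodmanWallachGTM255, Theorem 5.6.11 (proof: the modules M_μ and U_f ≅ M_{−(k+n/2)})] -/
theorem tds_X [CharZero k] (Δ : MvPolynomial σ k →ₗ[k] MvPolynomial σ k)
    (hΔ : ∀ f, Δ f = ∑ i : σ, pderiv i (pderiv i f)) (r2 : MvPolynomial σ k)
    (hr2 : r2 = ∑ i : σ, X i ^ 2) {f : MvPolynomial σ k} {m : ℕ} (hf : f.IsHomogeneous m)
    (hharm : Δ f = 0) (j : ℕ) :
    (-(1 / 2 : k)) • Δ ((1 / 2 ^ (j + 1) : k) • (r2 ^ (j + 1) * f)) =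
      (((j : k) + 1) * ((-((m : k) + (Fintype.card σ : k) / 2)) - (j : k))) •
        ((1 / 2 ^ j : k) • (r2 ^ j * f)) := by
  rw [map_smul, laplacian_rsq_pow_succ_mul Δ hΔ r2 hr2 hf hharm j, ← map_natCast C, C_mul',
    smul_smul, smul_smul, smul_smul]
  congr 1
  push_cast
  field_simp
  ring

/-! ## § 2. (5.89) is a direct sum -/

omit [Fintype σ] in
/-- `r² ≠ 0` (there is a variable). [folklore] -/
private theorem rsq_ne_zero' [Fintype σ] [Nonempty σ] (r2 : MvPolynomial σ k)
    (hr2 : r2 = ∑ i : σ, X i ^ 2) : r2 ≠ 0 := by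
  classical
  obtain ⟨i⟩ := ‹Nonempty σ›
  intro h
  have hc : coeff (Finsupp.single i 2) r2 = 1 := by
    rw [hr2, coeff_sum, Finset.sum_eq_single i]
    · rw [X_pow_eq_monomial, coeff_monomial, if_pos rfl]
    · intro j _ hji
      rw [X_pow_eq_monomial, coeff_monomial, if_neg]
      exact fun e => hji (Finsupp.single_left_injective (by norm_num) e)
    · intro hi; exact absurd (Finset.mem_univ i) hi
  rw [h, coeff_zero] at hc
  exact zero_ne_one hc

/-- **(5.89) is direct**: for `f ≠ 0` homogeneous, the polynomials `r^{2j} f` (`j ≥ 0`) are linearly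
independent, "since each summand is homogeneous of a different degree".
[cite: GoodmanWallachGTM255, Theorem 5.6.11 (proof, (5.88)–(5.89))] -/
theorem linearIndependent_rsq_pow_mul [Nonempty σ] (r2 : MvPolynomial σ k)
    (hr2 : r2 = ∑ i : σ, X i ^ 2) {f : MvPolynomial σ k} {m : ℕ} (hf : f.IsHomogeneous m)
    (hf0 : f ≠ 0) : LinearIndependent k (fun j : ℕ => r2 ^ j * f) := by
  classical
  rw [linearIndependent_iff']
  intro s c hc j hj
  -- take the homogeneous component of degree `2j + m`
  have hcomp := congrArg (homogeneousComponent (2 * j + m)) hc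
  rw [map_sum, map_zero, Finset.sum_eq_single j] at hcomp
  · rw [map_smul, homogeneousComponent_of_mem
      ((mem_homogeneousSubmodule _ _).mpr (rsq_pow_mul_isHomogeneous r2 hr2 hf j)), if_pos rfl] at hcomp
    rcases smul_eq_zero.mp hcomp with h | h
    · exact h
    · exact absurd h (mul_ne_zero (pow_ne_zero _ (rsq_ne_zero' r2 hr2)) hf0)
  · intro i _ hij
    rw [map_smul, homogeneousComponent_of_mem
      ((mem_homogeneousSubmodule _ _).mpr (rsq_pow_mul_isHomogeneous r2 hr2 hf i)),
      if_neg (by omega), smul_zero]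
  · intro hj'; exact absurd hj hj'

/-! ## § 3. `U_f = {p(r²) f : p ∈ k[t]}` and the action of `Δ` through `k[t]` -/

/-- **`Δ` on `U_f` through `k[t]`**: for `f ∈ ℋᵐ` and `p ∈ k[t]`,
`Δ(p(r²) f) = ((4m+2n) p′ + 4 t p″)(r²) · f` — the operator `π_μ(X)` of the proof of Theorem 5.6.11
transported to `k[t]` (`t^{j+1} ↦ 2(j+1)(2m+2j+n) t^j`).
[cite: GoodmanWallachGTM255, Theorem 5.6.11 (proof: the modules M_μ and (5.89))] -/
theorem laplacian_aeval_rsq_mul [CharZero k] (Δ : MvPolynomial σ k →ₗ[k] MvPolynomial σ k)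
    (hΔ : ∀ f, Δ f = ∑ i : σ, pderiv i (pderiv i f)) (r2 : MvPolynomial σ k)
    (hr2 : r2 = ∑ i : σ, X i ^ 2) {f : MvPolynomial σ k} {m : ℕ} (hf : f.IsHomogeneous m)
    (hharm : Δ f = 0) (p : Polynomial k) :
    Δ (Polynomial.aeval r2 p * f) =
      Polynomial.aeval r2 (Polynomial.C ((4 * m + 2 * Fintype.card σ : ℕ) : k) *
          Polynomial.derivative p +
        Polynomial.C (4 : k) * Polynomial.X * Polynomial.derivative (Polynomial.derivative p)) * f := by
  induction p using Polynomial.induction_on' with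
  | add p q hp hq =>
    simp only [map_add, add_mul, mul_add, hp, hq]
    abel
  | monomial j a =>
    rw [Polynomial.aeval_monomial, MvPolynomial.algebraMap_eq, mul_assoc, C_mul', map_smul]
    cases j with
    | zero =>
      simp only [pow_zero, one_mul, hharm, smul_zero, Polynomial.derivative_monomial, Nat.cast_zero,
        mul_zero, map_zero, add_zero, zero_mul]
    | succ j =>
      rw [laplacian_rsq_pow_succ_mul Δ hΔ r2 hr2 hf hharm j]
      -- the lowering operator on the monomial `a t^{j+1}`, evaluated at `r²`
      have e : Polynomial.aeval r2 (Polynomial.C ((4 * m + 2 * Fintype.card σ : ℕ) : k) *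
            Polynomial.derivative (Polynomial.monomial (j + 1) a) +
          Polynomial.C (4 : k) * Polynomial.X *
            Polynomial.derivative (Polynomial.derivative (Polynomial.monomial (j + 1) a))) =
          C (a * ((2 * (j + 1) * (2 * m + 2 * j + Fintype.card σ) : ℕ) : k)) * r2 ^ j := by
        cases j with
        | zero =>
          simp only [Polynomial.derivative_monomial_succ, Polynomial.derivative_monomial, Nat.cast_zero,
            mul_zero, map_zero, add_zero, map_add, map_mul, map_one,
            Polynomial.aeval_monomial, MvPolynomial.algebraMap_eq, map_natCast]
          push_cast
          ring
        | succ j =>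
          rw [Polynomial.derivative_monomial_succ, Polynomial.derivative_monomial_succ, mul_assoc,
            Polynomial.X_mul_monomial]
          simp only [map_add, map_mul, map_one, map_ofNat,
            Polynomial.aeval_monomial, MvPolynomial.algebraMap_eq, map_natCast]
          push_cast
          ring
      rw [e, MvPolynomial.smul_eq_C_mul, ← map_natCast C (2 * (j + 1) * _), map_mul]
      ring

/-- The coefficients of the lowering operator: `[(4m+2n) p′ + 4 t p″]_j = 2(j+1)(2m+2j+n) p_{j+1}`.
[folklore] -/
private theorem coeff_lowering (m : ℕ) (p : Polynomial k) (j : ℕ) :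
    (Polynomial.C ((4 * m + 2 * Fintype.card σ : ℕ) : k) * Polynomial.derivative p +
        Polynomial.C (4 : k) * Polynomial.X * Polynomial.derivative (Polynomial.derivative p)).coeff j =
      ((2 * (j + 1) * (2 * m + 2 * j + Fintype.card σ) : ℕ) : k) * p.coeff (j + 1) := by
  rw [Polynomial.coeff_add, Polynomial.coeff_C_mul, Polynomial.coeff_derivative, mul_assoc,
    Polynomial.coeff_C_mul]
  cases j with
  | zero =>
    rw [Polynomial.coeff_X_mul_zero, mul_zero, add_zero]
    push_cast; ring
  | succ j =>
    rw [Polynomial.coeff_X_mul, Polynomial.coeff_derivative, Polynomial.coeff_derivative]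
    push_cast; ring

/-- The lowering operator drops the degree by exactly one and kills only the constants
(characteristic `0`, `n ≥ 1`). [folklore] -/
private theorem natDegree_lowering [CharZero k] [Nonempty σ] (m : ℕ) {p : Polynomial k}
    (hp : 0 < p.natDegree) :
    (Polynomial.C ((4 * m + 2 * Fintype.card σ : ℕ) : k) * Polynomial.derivative p +
        Polynomial.C (4 : k) * Polynomial.X * Polynomial.derivative (Polynomial.derivative p)).natDegree
        < p.natDegree ∧
      (Polynomial.C ((4 * m + 2 * Fintype.card σ : ℕ) : k) * Polynomial.derivative p +
        Polynomial.C (4 : k) * Polynomial.X * Polynomial.derivative (Polynomial.derivative p)) ≠ 0 := by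
  set L := Polynomial.C ((4 * m + 2 * Fintype.card σ : ℕ) : k) * Polynomial.derivative p +
    Polynomial.C (4 : k) * Polynomial.X * Polynomial.derivative (Polynomial.derivative p) with hL
  obtain ⟨d, hd⟩ : ∃ d, p.natDegree = d + 1 := ⟨p.natDegree - 1, by omega⟩
  have hpos : ∀ j : ℕ, ((2 * (j + 1) * (2 * m + 2 * j + Fintype.card σ) : ℕ) : k) ≠ 0 := by
    intro j
    have : 0 < Fintype.card σ := Fintype.card_pos
    exact Nat.cast_ne_zero.mpr (Nat.mul_ne_zero (by omega) (by omega))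
  have hle : L.natDegree ≤ d := by
    rw [Polynomial.natDegree_le_iff_coeff_eq_zero]
    intro N hN
    rw [hL, coeff_lowering, Polynomial.coeff_eq_zero_of_natDegree_lt (by omega), mul_zero]
  have hp0 : p ≠ 0 := by rintro rfl; rw [Polynomial.natDegree_zero] at hd; omega
  have htop : L.coeff d ≠ 0 := by
    rw [hL, coeff_lowering]
    have hlc : p.coeff (d + 1) = p.leadingCoeff := by rw [Polynomial.leadingCoeff, hd]
    rw [hlc]
    exact mul_ne_zero (hpos d) (Polynomial.leadingCoeff_ne_zero.mpr hp0)
  refine ⟨by omega, fun h0 => htop (by rw [h0, Polynomial.coeff_zero])⟩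

/-! ## § 4. Theorem 5.6.11 (1): `U_f` is irreducible -/

/-- **Theorem 5.6.11 (1) / claim (⋆): `U_f` is irreducible under `X = −½Δ` and `Y = ½r²`.** Let
`f ∈ ℋᵐ`, `f ≠ 0` (char `0`, `n ≥ 1`). If a subspace `U` is stable under `Δ` and under
multiplication by `r²` and contains some nonzero `p(r²) f`, then it contains every `q(r²) f`, i.e.
all of `U_f = ⊕ⱼ k r^{2j} f`. Proof as printed: apply `X` until a nonzero multiple of `f` appears
("there exists `p` such that `Xᵖf ≠ 0` and `X^{p+1} f = 0` …"), then apply `Y`.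
[cite: GoodmanWallachGTM255, Theorem 5.6.11 (1) (proof, (⋆) and "Since V is irreducible, we must have V = U_f")] -/
theorem forall_aeval_rsq_mul_mem [CharZero k] [Nonempty σ]
    (Δ : MvPolynomial σ k →ₗ[k] MvPolynomial σ k)
    (hΔ : ∀ f, Δ f = ∑ i : σ, pderiv i (pderiv i f)) (r2 : MvPolynomial σ k)
    (hr2 : r2 = ∑ i : σ, X i ^ 2) {f : MvPolynomial σ k} {m : ℕ} (hf : f.IsHomogeneous m)
    (hharm : Δ f = 0) (U : Submodule k (MvPolynomial σ k)) (hUΔ : ∀ u ∈ U, Δ u ∈ U)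
    (hUr : ∀ u ∈ U, r2 * u ∈ U) {p : Polynomial k} (hp : p ≠ 0)
    (hpU : Polynomial.aeval r2 p * f ∈ U) (q : Polynomial k) : Polynomial.aeval r2 q * f ∈ U := by
  -- Step 1: `f ∈ U`, by induction on the degree of `p`
  have hfU : f ∈ U := by
    induction hd : p.natDegree using Nat.strong_induction_on generalizing p with
    | _ d ih =>
      rcases Nat.eq_zero_or_pos d with rfl | hdpos
      · -- `p` is a nonzero constant
        rw [Polynomial.eq_C_of_natDegree_eq_zero hd, Polynomial.aeval_C, MvPolynomial.algebraMap_eq,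
          C_mul'] at hpU
        have hc : p.coeff 0 ≠ 0 := by
          intro h0
          apply hp
          rw [Polynomial.eq_C_of_natDegree_eq_zero hd, h0, map_zero]
        simpa [smul_smul, inv_mul_cancel₀ hc] using U.smul_mem (p.coeff 0)⁻¹ hpU
      · -- lower the degree with `Δ`
        have hpos : 0 < p.natDegree := by rw [hd]; exact hdpos
        obtain ⟨hlt, hne⟩ := natDegree_lowering (k := k) (σ := σ) m hpos
        have hΔu := hUΔ _ hpU
        rw [laplacian_aeval_rsq_mul Δ hΔ r2 hr2 hf hharm] at hΔu
        exact ih _ (by rw [← hd]; exact hlt) hne hΔu rfl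
  -- Step 2: `r^{2j} f ∈ U` for all `j`, hence `q(r²) f ∈ U`
  have hpow : ∀ j : ℕ, r2 ^ j * f ∈ U := by
    intro j
    induction j with
    | zero => simpa using hfU
    | succ j ih => rw [pow_succ', mul_assoc]; exact hUr _ ih
  rw [Polynomial.aeval_eq_sum_range, Finset.sum_mul]
  refine U.sum_mem fun j _ => ?_
  rw [smul_mul_assoc]
  exact U.smul_mem _ (hpow j)

/-- **Theorem 5.6.11 (1), submodule form**: with `U_f = span_k {r^{2j} f : j ≥ 0}`, every subspace
`U` stable under `Δ` and `r²·` with `U ∩ U_f ≠ 0` contains `U_f`.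
[cite: GoodmanWallachGTM255, Theorem 5.6.11 (1) (proof, (⋆))] -/
theorem span_rsq_pow_mul_le [CharZero k] [Nonempty σ]
    (Δ : MvPolynomial σ k →ₗ[k] MvPolynomial σ k)
    (hΔ : ∀ f, Δ f = ∑ i : σ, pderiv i (pderiv i f)) (r2 : MvPolynomial σ k)
    (hr2 : r2 = ∑ i : σ, X i ^ 2) {f : MvPolynomial σ k} {m : ℕ} (hf : f.IsHomogeneous m)
    (hharm : Δ f = 0) (U : Submodule k (MvPolynomial σ k)) (hUΔ : ∀ u ∈ U, Δ u ∈ U)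
    (hUr : ∀ u ∈ U, r2 * u ∈ U) {u : MvPolynomial σ k} (hu0 : u ≠ 0) (huU : u ∈ U)
    (hu : u ∈ Submodule.span k (Set.range fun j : ℕ => r2 ^ j * f)) :
    Submodule.span k (Set.range fun j : ℕ => r2 ^ j * f) ≤ U := by
  -- write `u = p(r²) f`
  have hrange : ∀ w ∈ Submodule.span k (Set.range fun j : ℕ => r2 ^ j * f),
      ∃ p : Polynomial k, w = Polynomial.aeval r2 p * f := by
    intro w hw
    induction hw using Submodule.span_induction with
    | mem w hw =>
      obtain ⟨j, rfl⟩ := hw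
      exact ⟨Polynomial.X ^ j, by rw [Polynomial.aeval_X_pow]⟩
    | zero => exact ⟨0, by rw [map_zero, zero_mul]⟩
    | add w₁ w₂ _ _ h₁ h₂ =>
      obtain ⟨p₁, rfl⟩ := h₁
      obtain ⟨p₂, rfl⟩ := h₂
      exact ⟨p₁ + p₂, by rw [map_add, add_mul]⟩
    | smul a w _ h =>
      obtain ⟨p, rfl⟩ := h
      exact ⟨a • p, by rw [map_smul, smul_mul_assoc]⟩
  obtain ⟨p, rfl⟩ := hrange u hu
  have hp : p ≠ 0 := by rintro rfl; exact hu0 (by rw [map_zero, zero_mul])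
  rw [Submodule.span_le]
  rintro _ ⟨j, rfl⟩
  have := forall_aeval_rsq_mul_mem Δ hΔ r2 hr2 hf hharm U hUΔ hUr hp huU (Polynomial.X ^ j)
  rwa [Polynomial.aeval_X_pow] at this

/-! ## § 5. Theorem 5.6.11 (2): `k[t] ⊗ ℋᵐ → 𝒫`, `ψ ⊗ f ↦ ψ(r²) f`, is injective -/

/-- **The family `r^{2p} f_j` is linearly independent** for a linearly independent family `(f_j)` of
homogeneous polynomials of one degree `m` (`n ≥ 1`): the relation `∑ c_{jp} r^{2p} f_j = 0` splits
by degrees `m + 2p` ("by homogeneity"), and `r^{2p}` is a non-zero-divisor.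
[cite: GoodmanWallachGTM255, Theorem 5.6.11 (2) (proof: "Suppose Σ_j ψ_j(r²)f_j = 0 … by homogeneity … c_j = 0")] -/
theorem linearIndependent_rsq_pow_mul_family [Nonempty σ] (r2 : MvPolynomial σ k)
    (hr2 : r2 = ∑ i : σ, X i ^ 2) {ι' : Type*} {f : ι' → MvPolynomial σ k} {m : ℕ}
    (hf : ∀ j, (f j).IsHomogeneous m) (hli : LinearIndependent k f) :
    LinearIndependent k (fun jp : ι' × ℕ => r2 ^ jp.2 * f jp.1) := by
  classical
  rw [linearIndependent_iff'] at hli ⊢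
  intro s c hc jp₀ hjp₀
  obtain ⟨j₀, p⟩ := jp₀
  -- the homogeneous component of degree `2p + m` of the relation
  have hcomp := congrArg (homogeneousComponent (2 * p + m)) hc
  rw [map_sum, map_zero] at hcomp
  have hterm : ∀ jp ∈ s, homogeneousComponent (2 * p + m) (c jp • (r2 ^ jp.2 * f jp.1)) =
      if jp.2 = p then c jp • (r2 ^ p * f jp.1) else 0 := by
    intro jp _
    rw [map_smul, homogeneousComponent_of_mem ((mem_homogeneousSubmodule _ _).mpr
      (rsq_pow_mul_isHomogeneous r2 hr2 (hf jp.1) jp.2))]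
    by_cases h : jp.2 = p
    · rw [if_pos (by rw [h]), if_pos h, h]
    · rw [if_neg (by omega), if_neg h, smul_zero]
  rw [Finset.sum_congr rfl hterm, ← Finset.sum_filter] at hcomp
  -- pull out the common factor `r^{2p}`
  have hsum : r2 ^ p * ∑ jp ∈ s.filter (fun jp => jp.2 = p), c jp • f jp.1 = 0 := by
    rw [Finset.mul_sum, ← hcomp]
    exact Finset.sum_congr rfl fun jp _ => by rw [mul_smul_comm]
  have hsum' : ∑ jp ∈ s.filter (fun jp => jp.2 = p), c jp • f jp.1 = 0 :=
    (mul_eq_zero.mp hsum).resolve_left (pow_ne_zero _ (rsq_ne_zero' r2 hr2))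
  -- reindex by the first coordinate and use the independence of `(f_j)`
  set t : Finset ι' := (s.filter (fun jp => jp.2 = p)).image Prod.fst with ht
  have hinj : Set.InjOn Prod.fst (s.filter (fun jp : ι' × ℕ => jp.2 = p) : Set (ι' × ℕ)) := by
    rintro ⟨j₁, p₁⟩ h₁ ⟨j₂, p₂⟩ h₂ h
    simp only [Finset.coe_filter, Set.mem_setOf_eq] at h₁ h₂
    simp only at h
    rw [h, h₁.2, h₂.2]
  have hreindex : ∑ j ∈ t, c (j, p) • f j = ∑ jp ∈ s.filter (fun jp => jp.2 = p), c jp • f jp.1 := by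
    rw [ht, Finset.sum_image hinj]
    refine Finset.sum_congr rfl fun jp hjp => ?_
    rw [Finset.mem_filter] at hjp
    rw [← hjp.2]
  have hzero := hli t (fun j => c (j, p)) (by rw [hreindex, hsum']) j₀ (by
    rw [ht, Finset.mem_image]
    exact ⟨(j₀, p), Finset.mem_filter.mpr ⟨hjp₀, rfl⟩, rfl⟩)
  exact hzero

/-- **Theorem 5.6.11 (2), injectivity**: if `f_1, …, f_N ∈ ℋᵐ` (homogeneous of degree `m`) are
linearly independent and `∑_j ψ_j(r²) f_j = 0` for polynomials `ψ_j ∈ k[t]`, then all `ψ_j = 0`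
— the multiplication map `k[t] ⊗ ℋᵐ → 𝒫`, `ψ ⊗ f ↦ ψ(r²) f`, is injective.
[cite: GoodmanWallachGTM255, Theorem 5.6.11 (2) (proof)] -/
theorem eq_zero_of_sum_aeval_rsq_mul_eq_zero [Nonempty σ] (r2 : MvPolynomial σ k)
    (hr2 : r2 = ∑ i : σ, X i ^ 2) {ι' : Type*} [Fintype ι'] {f : ι' → MvPolynomial σ k} {m : ℕ}
    (hf : ∀ j, (f j).IsHomogeneous m) (hli : LinearIndependent k f) (ψ : ι' → Polynomial k)
    (hψ : ∑ j, Polynomial.aeval r2 (ψ j) * f j = 0) : ∀ j, ψ j = 0 := by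
  classical
  have hLI := linearIndependent_rsq_pow_mul_family r2 hr2 hf hli
  rw [linearIndependent_iff'] at hLI
  -- a common bound on the degrees
  obtain ⟨N, hN⟩ : ∃ N, ∀ j, (ψ j).natDegree < N :=
    ⟨(Finset.univ.sup fun j => (ψ j).natDegree) + 1, fun j =>
      Nat.lt_succ_of_le (Finset.le_sup (f := fun j => (ψ j).natDegree) (Finset.mem_univ j))⟩
  -- expand the relation over the family `r^{2p} f_j`
  have hrel : ∑ jp ∈ (Finset.univ : Finset ι') ×ˢ Finset.range N,
      (ψ jp.1).coeff jp.2 • (r2 ^ jp.2 * f jp.1) = 0 := by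
    rw [Finset.sum_product, ← hψ]
    refine Finset.sum_congr rfl fun j _ => ?_
    rw [Polynomial.aeval_eq_sum_range' (hN j), Finset.sum_mul]
    exact Finset.sum_congr rfl fun p _ => by rw [smul_mul_assoc]
  intro j
  ext p
  rw [Polynomial.coeff_zero]
  by_cases hp : p < N
  · exact hLI _ (fun jp => (ψ jp.1).coeff jp.2) hrel (j, p)
      (Finset.mem_product.mpr ⟨Finset.mem_univ j, Finset.mem_range.mpr hp⟩)
  · exact Polynomial.coeff_eq_zero_of_natDegree_lt (lt_of_lt_of_le (hN j) (not_lt.mp hp))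

end Literature.RepresentationTheory.ClassicalInvariants.SphericalHarmonicsSL2
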